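import Mathlib
import Summits.NavierStokesRegularity.NavierStokesRegularity.Theorems.EulerZoomLiouvillePowerGaugeEulerLiouvilleFlux
import HarnessLib

/-!
# «No Euler collapse FROM REST» in the power-gauged class, modulo finite-window flux — a corollary of the
# finite-backward-flux stratum of the crux `EulerZoomLiouville.PowerGaugeEulerLiouville`

Route `EulerZoomLiouville` (NavierStokesRegularity), crux E = stmt-NavierStokesRegularity-19832
`PowerGaugeEulerLiouville` (OPEN on `0 < ρ ≤ 1/2`); lead's line `birth`, open core `stub_noCollapseFromZero`.
The finite-backward-flux stratum (`…Flux.lean`, `powerGaugeEulerLiouville_finiteBackwardFlux`) kills every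
member whose weighted flux `(|u|³ + 2|p||u|)/max(1,|x|)` is integrable on `(−∞, b) × ℝ³`.  For a member AT
REST BEFORE SOME TIME (`u(t,·) = 0` for `t < −T`) the flux density vanishes for `t < −T`, so only the
FINITE-WINDOW integrability `∫_{(a,b)×ℝ³} (|u|³ + 2|p||u|)/max(1,|x|) < ∞` (`a < b < 0`) is needed:

* `integrableOn_Iio_of_window_of_rest` — bookkeeping: zero before `−T` + integrable on `(−T−1, b) × ℝ³`
  ⇒ integrable on `(−∞, b) × ℝ³`;
* `powerGaugeEulerLiouville_fromRest_of_windowFlux` — **a member of E that is at rest before some time and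
  has finite weighted flux on finite time windows is trivial** (every `ρ > 0`).

TARGET LEFT OPEN FOR A SUCCESSOR (the in-window analytic half, NOT proved here): the finite-window flux
bound FROM THE GAUGES.  Lead's estimate (NOTES.md of prover-ns-ezl-19832-p1-g0): on the shell `|x| ~ a`,
window of length `T ≪ a²`, the unit-scale cubic bound `∫∫_{(0,τ)×B₁}|v|³ ≤ K C^{3/2}(τ + τ^{1/4})` (tree
`exists_lintegral_cube_cylinder_le`) rescaled with `C ~ c a^{−2−ρ}`, `τ = T/a²` gives
`∫_{window}∫_{B_a}|u|³ ≲ a^{3/2 − 3ρ/2}`, hence shell flux `≲ a^{1/2 − 3ρ/2}` (summable iff `ρ > 1/3`); the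
pressure part by Hölder with the `D`-gauge `≲ a^{5/6 − 11ρ/6}` (summable iff `ρ > 5/11`).  So «no collapse
from rest» should hold UNCONDITIONALLY for `5/11 < ρ ≤ 1/2` — an in-window rung exercising the LEI flux
lever (K-READ 01 §K5); typing it needs the parabolic rescaling of the tree's unit-scale cubic estimate.
WHAT THIS IS NOT: not NS, not the open core (self-similar collapse is never at rest). [folklore]
-/

noncomputable section

set_option linter.dupNamespace false

open MeasureTheory Set Filter Topology Metric Function TopologicalSpace
open scoped ENNReal NNReal InnerProductSpace RealInnerProductSpace

namespace Summit.NavierStokesRegularity.NavierStokesRegularity.Theorems.PowerGaugeEulerLiouville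

open Literature.Analysis Literature.Analysis.FunctionSpaces Literature.Analysis.FluidPDE

/-- Bookkeeping: a function vanishing on `(−∞, −T] × ℝ³` and integrable on `(−T−1, b) × ℝ³` is
integrable on `(−∞, b) × ℝ³`. [folklore] -/
theorem integrableOn_Iio_of_window_of_rest {g : ℝ × EuclideanSpace ℝ (Fin 3) → ℝ} {T b : ℝ}
    (hzero : ∀ z : ℝ × EuclideanSpace ℝ (Fin 3), z.1 < -T → g z = 0)
    (hwin : IntegrableOn g (Ioo (-T - 1) b ×ˢ (univ : Set (EuclideanSpace ℝ (Fin 3)))) volume) :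
    IntegrableOn g (Iio b ×ˢ (univ : Set (EuclideanSpace ℝ (Fin 3)))) volume := by
  have hsplit : Iio b ×ˢ (univ : Set (EuclideanSpace ℝ (Fin 3))) ⊆
      (Iic (-T - 1) ×ˢ (univ : Set (EuclideanSpace ℝ (Fin 3)))) ∪
        (Ioo (-T - 1) b ×ˢ (univ : Set (EuclideanSpace ℝ (Fin 3)))) := by
    rintro ⟨t, x⟩ ⟨ht, -⟩
    rcases le_or_gt t (-T - 1) with h | h
    · exact Or.inl ⟨h, mem_univ _⟩
    · exact Or.inr ⟨⟨h, ht⟩, mem_univ _⟩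
  refine IntegrableOn.mono_set (IntegrableOn.union ?_ hwin) hsplit
  refine (integrableOn_zero).congr_fun (fun z hz => ?_) (measurableSet_Iic.prod MeasurableSet.univ)
  have hz1 : z.1 ≤ -T - 1 := (mem_prod.1 hz).1
  exact (hzero z (by linarith)).symm

/-- **No Euler collapse from rest in the power-gauged class, modulo finite-window flux** (every `ρ > 0`):
the crux VERBATIM plus (i) `u(t, ·) = 0` for all `t < −T` and (ii) the weighted flux
`(|u|³ + 2|p||u|)/max(1,|x|)` is integrable on every finite window `(a, b) × ℝ³`, `b < 0` ⇒ `u = 0` a.e.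
(`powerGaugeEulerLiouville_finiteBackwardFlux` with the flux density vanishing before `−T`). [folklore] -/
theorem powerGaugeEulerLiouville_fromRest_of_windowFlux :
    ∀ ρ : ℝ, 0 < ρ → ∀ (u : ℝ → EuclideanSpace ℝ (Fin 3) → EuclideanSpace ℝ (Fin 3))
      (p : ℝ → EuclideanSpace ℝ (Fin 3) → ℝ)
      (H : ℝ → EuclideanSpace ℝ (Fin 3) → EuclideanSpace ℝ (Fin 3) →L[ℝ] EuclideanSpace ℝ (Fin 3)) (c : ℝ≥0),
      IsSuitableWeakSolutionOn (slab (EuclideanSpace ℝ (Fin 3)) (Set.Iio 0) isOpen_Iio) 0 0 u p →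
      HasWeakSpatialGradientOn (slab (EuclideanSpace ℝ (Fin 3)) (Set.Iio 0) isOpen_Iio) u H →
      (∀ a : ℝ, 0 < a → ENNReal.ofReal (a ^ (2 * ρ)) * cknA a (0 : ℝ × EuclideanSpace ℝ (Fin 3)) u +
        ENNReal.ofReal (a ^ ρ) * cknE a (0 : ℝ × EuclideanSpace ℝ (Fin 3)) H +
        ENNReal.ofReal (a ^ (2 * ρ)) * cknD a (0 : ℝ × EuclideanSpace ℝ (Fin 3)) p ≤ (c : ℝ≥0∞)) →
      (∃ T : ℝ, ∀ t : ℝ, t < -T → ∀ x : EuclideanSpace ℝ (Fin 3), u t x = 0) →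
      (∀ a b : ℝ, a < b → b < 0 → IntegrableOn
        (fun z : ℝ × EuclideanSpace ℝ (Fin 3) => (‖u z.1 z.2‖ ^ 3 + 2 * |p z.1 z.2| * ‖u z.1 z.2‖) / max 1 ‖z.2‖)
        (Set.Ioo a b ×ˢ (Set.univ : Set (EuclideanSpace ℝ (Fin 3)))) volume) →
      Function.uncurry u =ᵐ[volume.restrict (Set.Iio (0 : ℝ) ×ˢ (Set.univ : Set (EuclideanSpace ℝ (Fin 3))))] 0 := by
  intro ρ hρ u p H c hsw hH hc ⟨T, hT⟩ hwin
  refine powerGaugeEulerLiouville_finiteBackwardFlux ρ hρ u p H c hsw hH hc fun b hb => ?_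
  rcases lt_or_ge (-T - 1) b with h | h
  · refine integrableOn_Iio_of_window_of_rest (T := T) (fun z hz => ?_) (hwin _ _ h hb)
    simp [hT z.1 hz z.2]
  · -- the whole region `(−∞, b) × ℝ³` lies before `−T`: the density vanishes there
    refine (integrableOn_zero).congr_fun (fun z hz => ?_) (measurableSet_Iio.prod MeasurableSet.univ)
    have hz1 : z.1 < b := (mem_prod.1 hz).1
    have : z.1 < -T := by linarith
    simp [hT z.1 this z.2]

end Summit.NavierStokesRegularity.NavierStokesRegularity.Theorems.PowerGaugeEulerLiouville

end
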